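import Literature.NumberTheory.Automorphic.UnitOrbitalIntegralFixedPointsVolume   -- ★ p842426 brick (1): `Φ(⟦γ⟧, 𝟙_C) = #Fix_γ(G ⧸ C) · ν(C)` at an elliptic regular class
import Literature.NumberTheory.Automorphic.LocalOrbitalIntegralIndicator           -- ★ `UnitaryGroup.classOrbitalIntegral_add_of_isAdmissibleOn`
import Literature.NumberTheory.Automorphic.UnitaryUnitOrbitalIntegralLatticeCount  -- ★ `natCard_fixedBy_quotient_congr` (transport to a one-place model)
import Literature.NumberTheory.Rogawski1990.RankOneEulerPoincareNonsplit           -- ★ the letter (R2) `RankOneEulerPoincareNonsplit` (tokens)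
import Literature.NumberTheory.Rogawski1990.LocalTransferGlue                      -- ★ `IsLocSmooth.add`
import Literature.NumberTheory.Rogawski1990.RegularEltLocalisation                 -- ★ `isRegularElt_out_mk_local`
import HarnessLib

/-!
# [Kottwitz1988 §2; Rogawski1990 §12.6] (R2-g) The Euler–Poincaré GLUE: from the fixed-point counts on the tree to the pseudo-coefficient of `𝟙`

Topic `NumberTheory/Rogawski1990`; namespace `Literature.NumberTheory.Rogawski1990`.  KERNEL LANE: theorems only (no `def`, no instance, no notation, no
`sorry`, default heartbeats).  Cell `pub/hodgecm-mathlib` (D-0151), crux H413 = stmt-HodgeConjecture-24833, line «N6nsGerm» residual `stub_N6nsR2EP :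
RankOneEulerPoincareNonsplit` (★ p841621), (R2) EP road (desk F0P3-plan (g8) 08:07:50Z, LEAD F0P3a-plan (g10) WORD T9-1 (0)); seat B-p14 (g31), brick (R2-g).
HONEST LABEL: HC_CM is proved only modulo the printed citations until rung 0 closes; this file discharges NO count — it is the uniformity ∕ `IsLocSmooth` ∕ linearity
glue of the road, with the counts as NAMED BINDERS.

THE PRINT.  [Kottwitz1988] §2: for a reductive `G` over a `p`-adic field the Euler–Poincaré function is `f_EP := Σ_σ (−1)^{dim σ} ν(G_σ)⁻¹ 𝟙_{G_σ}` over representatives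
`σ` of the `G`-orbits of facets of the Bruhat–Tits building (no orientation characters when `G` acts without inversions), and Theorem 2: `O_γ(f_EP) = 1` (the Euler
characteristic of the — finite, contractible — fixed-point set `B^γ`) for `γ` regular ELLIPTIC, `O_γ(f_EP) = 0` for `γ` regular non-elliptic.  For the rank-one
quasi-split unitary group `U₂ = U(Φ₂)(L⁺_v)` at an unramified non-split `v` the building is the `(q+1)`-regular tree with two vertex orbits (stabilisers `K`, `K′`) and
one edge orbit (Iwahori `I = K ∩ K′`), so `f_EP = ν(K)⁻¹𝟙_K + ν(K′)⁻¹𝟙_{K′} − ν(I)⁻¹𝟙_I` ([Rogawski1990] §12.6 p. 174: the pseudo-coefficient of the trivial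
representation, «existence … follows from [K]»).

WHAT THIS FILE PROVES (all places, all ranks where meaningful; the tree∕building dictionary is NOT used — it enters only through the binders):
* §1 `IsLocSmooth.const_smul`, `IsLocSmooth.neg`, `IsLocSmooth.sub` — `C_c^∞` is a `ℂ`-submodule (with ★ `IsLocSmooth.add`).
* §2 on `U(H)(L⁺_v) = (cmDatum L N H).Local v` (`H` hermitian, `det H ≠ 0`), `m` CANONICAL for the regular classes (★ `IsCanonical`):
  `classOrbitalIntegral_const_smul` (homogeneity, any class); `classOrbitalIntegral_sub_of_isLocSmooth` (at a regular class);
  `isLocSmooth_epCombination` and `classOrbitalIntegral_epCombination_eq` — for compact open subgroups `K K′ I` and scalars `a b c : ℂ`,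
  `g ↦ a·𝟙_K g + b·𝟙_{K′} g − c·𝟙_I g ∈ C_c^∞` and `Φ(⟦γ⟧, ·) = a Φ(⟦γ⟧,𝟙_K) + b Φ(⟦γ⟧,𝟙_{K′}) − c Φ(⟦γ⟧,𝟙_I)` at every regular `γ`;
  `classOrbitalIntegral_epCombination_eq_of_compactSpace` — at an ELLIPTIC regular `γ` with `a = ν(K)⁻¹, b = ν(K′)⁻¹, c = ν(I)⁻¹` the value is
  `#Fix_γ(G⧸K) + #Fix_γ(G⧸K′) − #Fix_γ(G⧸I)` (★ p842426 `classOrbitalIntegral_indicator_complex_local_eq_natCard_fixedBy_mul`, three times);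
  **`exists_isLocSmooth_classOrbitalIntegral_eq_one_zero_of_relations`** — THE GLUE: from the two relations
  (E) `∀ γ` regular elliptic, `#Fix_γ(G⧸K) + #Fix_γ(G⧸K′) = #Fix_γ(G⧸I) + 1` (Euler characteristic of the fixed subtree) and
  (N) `∀ γ` regular non-elliptic, `ν(K)⁻¹Φ(⟦γ⟧,𝟙_K) + ν(K′)⁻¹Φ(⟦γ⟧,𝟙_{K′}) − ν(I)⁻¹Φ(⟦γ⟧,𝟙_I) = 0` (vertices − edges per period of the split torus),
  `∃ f ∈ C_c^∞, Φ(⟦γ⟧, f) = 1` (elliptic regular) `∧ Φ(⟦γ⟧, f) = 0` (non-elliptic regular) — the body of ★ `RankOneEulerPoincareNonsplit` at `(L, v, ν, m)`.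
  `…_of_relations_congr` ∕ `…_congr'` — the same with (E) read on a ONE-PLACE MODEL `e : U(H)(L⁺_v) ≃* U_w` ∕ `≃ₜ* U_w` (`C := C_w.comap e`, ★ `natCard_fixedBy_quotient_congr`), the
  currency of the road's counts (B-p04 (g34) 08:08:02Z spelling of record: `K_w`, `K′_w`, `I_w := K_w ⊓ K′_w`, `e = localNonsplitEquiv …`).
* The `U₂ = U(Φ₂)(L⁺_v)` specialisation and the ASSEMBLY SKELETON `rankOneEulerPoincareNonsplit_of_relations` (the letter from «(E) ∧ (N) at every non-split
  place») live in the sibling file `RankOneEulerPoincareGlueRankOne.lean` (400-line rule).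

## References
* [Kottwitz1988] R. E. Kottwitz, *Tamagawa numbers*, Ann. of Math. 127 (1988) 629–646: §2, Theorem 2.
* [Rogawski1990] J. D. Rogawski, *Automorphic Representations of Unitary Groups in Three Variables*, Ann. of Math. Stud. 123 (1990): §1.6 p. 6 (`C(G, ω)`), §4.9 p. 54
  (orbital integrals), §12.6 p. 174 (pseudo-coefficients).
* [Laumon1995] G. Laumon, *Cohomology of Drinfeld Modular Varieties I*, CUP (1996): Lemma (5.3.2) p. 136, Thm. (5.1.3).
* [Serre1980Trees] J.-P. Serre, *Trees*, Springer (1980): II.1.1 (the tree of `SL₂` over a local field).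
-/

noncomputable section

open NumberField IsDedekindDomain MeasureTheory Measure
open Literature.NumberTheory.Automorphic
open scoped Matrix MatrixGroups

namespace Literature.NumberTheory.Rogawski1990

/-! ## §1 `C_c^∞(X)` is a `ℂ`-submodule -/

section LocSmooth

variable {X : Type*} [TopologicalSpace X]

/-- `a • φ ∈ C_c^∞` for `φ ∈ C_c^∞`, `a ∈ ℂ`. [cite: Rogawski1990, §1.6 p. 6] -/
theorem IsLocSmooth.const_smul {φ : X → ℂ} (hφ : IsLocSmooth φ) (a : ℂ) : IsLocSmooth (a • φ) :=
  ⟨hφ.1.comp fun z => a * z, hφ.2.mono (Function.support_const_smul_subset a φ)⟩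

/-- `-φ ∈ C_c^∞` for `φ ∈ C_c^∞`. [cite: Rogawski1990, §1.6 p. 6] -/
theorem IsLocSmooth.neg {φ : X → ℂ} (hφ : IsLocSmooth φ) : IsLocSmooth (-φ) := by
  have h := hφ.const_smul (-1)
  rwa [neg_one_smul] at h

/-- `φ − ψ ∈ C_c^∞` for `φ, ψ ∈ C_c^∞`. [cite: Rogawski1990, §1.6 p. 6] -/
theorem IsLocSmooth.sub {φ ψ : X → ℂ} (hφ : IsLocSmooth φ) (hψ : IsLocSmooth ψ) : IsLocSmooth (φ - ψ) := by
  rw [sub_eq_add_neg]; exact hφ.add hψ.neg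

end LocSmooth

/-! ## §2 On `U(H)(L⁺_v)`: linearity, the three-term combination, the glue -/

section Generic

variable {G : Type*} [Group G] [∀ γ : G, MeasurableSpace (G ⧸ Subgroup.centralizer ({γ} : Set G))]

/-- **Homogeneity `Φ(c, a • f; m) = a · Φ(c, f; m)`** (no integrability needed). [cite: Rogawski1990, §4.9 p. 54] -/
theorem classOrbitalIntegral_const_smul (m : OrbitalMeasureFamily G) (a : ℂ) (f : G → ℂ) (c : ConjClasses G) :
    classOrbitalIntegral m (a • f) c = a * classOrbitalIntegral m f c := by
  rw [classOrbitalIntegral_eq, orbitalIntegral_smul, ← classOrbitalIntegral_eq, smul_eq_mul]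

end Generic

section CM

variable (L : Type) [Field L] [NumberField L] [IsCMField L] (N : ℕ) (H : Matrix (Fin N) (Fin N) L) (v : HeightOneSpectrum (𝓞 ↥(maximalRealSubfield L)))
  [MeasurableSpace ((UnitaryGroup.cmDatum L N H).Local v)] [BorelSpace ((UnitaryGroup.cmDatum L N H).Local v)]
  [∀ γ : (UnitaryGroup.cmDatum L N H).Local v,
    MeasurableSpace ((UnitaryGroup.cmDatum L N H).Local v ⧸ Subgroup.centralizer ({γ} : Set ((UnitaryGroup.cmDatum L N H).Local v)))]
  [∀ γ : (UnitaryGroup.cmDatum L N H).Local v,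
    BorelSpace ((UnitaryGroup.cmDatum L N H).Local v ⧸ Subgroup.centralizer ({γ} : Set ((UnitaryGroup.cmDatum L N H).Local v)))]
  (ν : Measure ((UnitaryGroup.cmDatum L N H).Local v)) [IsHaarMeasure ν] [ν.IsMulRightInvariant]

omit [MeasurableSpace ((UnitaryGroup.cmDatum L N H).Local v)] [BorelSpace ((UnitaryGroup.cmDatum L N H).Local v)] in
/-- **`Φ(⟦γ⟧, F − G) = Φ(⟦γ⟧, F) − Φ(⟦γ⟧, G)`** at a REGULAR `γ ∈ U(H)(L⁺_v)` for `F, G ∈ C_c^∞` and a family admissible on the regular classes (★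
`classOrbitalIntegral_add_of_isAdmissibleOn` with `−G`; ★ `isRegularElt_out_mk_local`). [cite: Rogawski1990, §4.9 p. 54] -/
theorem classOrbitalIntegral_sub_of_isLocSmooth (hH : (H.map (cmConjRingHom L))ᵀ = H) (hdet : H.det ≠ 0)
    {m : OrbitalMeasureFamily ((UnitaryGroup.cmDatum L N H).Local v)}
    (hm : m.IsAdmissibleOn fun γ' => IsRegularElt (γ'.val : GL (Fin N) (UnitaryGroup.LocalRing L v)))
    (γ : (UnitaryGroup.cmDatum L N H).Local v) (hreg : IsRegularElt (γ.val : GL (Fin N) (UnitaryGroup.LocalRing L v)))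
    {F G : (UnitaryGroup.cmDatum L N H).Local v → ℂ} (hF : IsLocSmooth F) (hG : IsLocSmooth G) :
    classOrbitalIntegral m (F - G) (ConjClasses.mk γ) = classOrbitalIntegral m F (ConjClasses.mk γ) - classOrbitalIntegral m G (ConjClasses.mk γ) := by
  rw [sub_eq_add_neg, UnitaryGroup.classOrbitalIntegral_add_of_isAdmissibleOn L N H v hH hdet hm (ConjClasses.mk γ) (isRegularElt_out_mk_local hreg)
    hF.continuous hF.hasCompactSupport hG.neg.continuous hG.neg.hasCompactSupport, ← neg_one_smul ℂ G, classOrbitalIntegral_const_smul, neg_one_mul,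
    ← sub_eq_add_neg]

/-- **The three-term combination `g ↦ a·𝟙_K g + b·𝟙_{K′} g − c·𝟙_I g` of indicators of compact open subgroups is in `C_c^∞`** (★ `isLocSmooth_indicator_subgroup`; §1).
With `a = ν(K)⁻¹, b = ν(K′)⁻¹, c = ν(I)⁻¹` this is Kottwitz's `f_EP` on the tree. [cite: Kottwitz1988, §2] [cite: Rogawski1990, §4.9 Prop. 4.9.1 (b) p. 55] -/
theorem isLocSmooth_epCombination {G : Type*} [Group G] [TopologicalSpace G] [ContinuousMul G] (K K' I : Subgroup G)
    (hKo : IsOpen (K : Set G)) (hKc : IsCompact (K : Set G)) (hK'o : IsOpen (K' : Set G)) (hK'c : IsCompact (K' : Set G))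
    (hIo : IsOpen (I : Set G)) (hIc : IsCompact (I : Set G)) (a b c : ℂ) :
    IsLocSmooth fun g => a * (K : Set G).indicator (fun _ => (1 : ℂ)) g + b * (K' : Set G).indicator (fun _ => (1 : ℂ)) g -
      c * (I : Set G).indicator (fun _ => (1 : ℂ)) g :=
  (((isLocSmooth_indicator_subgroup K hKo hKc).const_smul a).add ((isLocSmooth_indicator_subgroup K' hK'o hK'c).const_smul b)).sub
    ((isLocSmooth_indicator_subgroup I hIo hIc).const_smul c)

omit [MeasurableSpace ((UnitaryGroup.cmDatum L N H).Local v)] [BorelSpace ((UnitaryGroup.cmDatum L N H).Local v)] in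
/-- **Linearity at a regular class: `Φ(⟦γ⟧, a𝟙_K + b𝟙_{K′} − c𝟙_I) = a Φ(⟦γ⟧,𝟙_K) + b Φ(⟦γ⟧,𝟙_{K′}) − c Φ(⟦γ⟧,𝟙_I)`** on `U(H)(L⁺_v)` for a family admissible on the
regular classes (in particular a canonical one, ★ `IsCanonical.isAdmissibleOn`). [cite: Rogawski1990, §4.9 p. 54] [cite: Kottwitz1988, §2] -/
theorem classOrbitalIntegral_epCombination_eq (hH : (H.map (cmConjRingHom L))ᵀ = H) (hdet : H.det ≠ 0)
    {m : OrbitalMeasureFamily ((UnitaryGroup.cmDatum L N H).Local v)}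
    (hm : m.IsAdmissibleOn fun γ' => IsRegularElt (γ'.val : GL (Fin N) (UnitaryGroup.LocalRing L v)))
    (K K' I : Subgroup ((UnitaryGroup.cmDatum L N H).Local v))
    (hKo : IsOpen (K : Set ((UnitaryGroup.cmDatum L N H).Local v))) (hKc : IsCompact (K : Set ((UnitaryGroup.cmDatum L N H).Local v)))
    (hK'o : IsOpen (K' : Set ((UnitaryGroup.cmDatum L N H).Local v))) (hK'c : IsCompact (K' : Set ((UnitaryGroup.cmDatum L N H).Local v)))
    (hIo : IsOpen (I : Set ((UnitaryGroup.cmDatum L N H).Local v))) (hIc : IsCompact (I : Set ((UnitaryGroup.cmDatum L N H).Local v))) (a b c : ℂ)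
    (γ : (UnitaryGroup.cmDatum L N H).Local v) (hreg : IsRegularElt (γ.val : GL (Fin N) (UnitaryGroup.LocalRing L v))) :
    classOrbitalIntegral m (fun g => a * (K : Set ((UnitaryGroup.cmDatum L N H).Local v)).indicator (fun _ => (1 : ℂ)) g +
        b * (K' : Set ((UnitaryGroup.cmDatum L N H).Local v)).indicator (fun _ => (1 : ℂ)) g -
        c * (I : Set ((UnitaryGroup.cmDatum L N H).Local v)).indicator (fun _ => (1 : ℂ)) g) (ConjClasses.mk γ) =
      a * classOrbitalIntegral m ((K : Set ((UnitaryGroup.cmDatum L N H).Local v)).indicator fun _ => (1 : ℂ)) (ConjClasses.mk γ) +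
        b * classOrbitalIntegral m ((K' : Set ((UnitaryGroup.cmDatum L N H).Local v)).indicator fun _ => (1 : ℂ)) (ConjClasses.mk γ) -
        c * classOrbitalIntegral m ((I : Set ((UnitaryGroup.cmDatum L N H).Local v)).indicator fun _ => (1 : ℂ)) (ConjClasses.mk γ) := by
  have hK := isLocSmooth_indicator_subgroup K hKo hKc
  have hK' := isLocSmooth_indicator_subgroup K' hK'o hK'c
  have hI := isLocSmooth_indicator_subgroup I hIo hIc
  have hfun : (fun g => a * (K : Set ((UnitaryGroup.cmDatum L N H).Local v)).indicator (fun _ => (1 : ℂ)) g +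
        b * (K' : Set ((UnitaryGroup.cmDatum L N H).Local v)).indicator (fun _ => (1 : ℂ)) g -
        c * (I : Set ((UnitaryGroup.cmDatum L N H).Local v)).indicator (fun _ => (1 : ℂ)) g) =
      (a • (K : Set ((UnitaryGroup.cmDatum L N H).Local v)).indicator (fun _ => (1 : ℂ)) +
        b • (K' : Set ((UnitaryGroup.cmDatum L N H).Local v)).indicator (fun _ => (1 : ℂ))) -
        c • (I : Set ((UnitaryGroup.cmDatum L N H).Local v)).indicator (fun _ => (1 : ℂ)) := by
    funext g
    simp only [Pi.sub_apply, Pi.add_apply, Pi.smul_apply, smul_eq_mul]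
  rw [hfun, classOrbitalIntegral_sub_of_isLocSmooth L N H v hH hdet hm γ hreg ((hK.const_smul a).add (hK'.const_smul b)) (hI.const_smul c),
    UnitaryGroup.classOrbitalIntegral_add_of_isAdmissibleOn L N H v hH hdet hm (ConjClasses.mk γ) (isRegularElt_out_mk_local hreg)
      (hK.const_smul a).continuous (hK.const_smul a).hasCompactSupport (hK'.const_smul b).continuous (hK'.const_smul b).hasCompactSupport,
    classOrbitalIntegral_const_smul, classOrbitalIntegral_const_smul, classOrbitalIntegral_const_smul]

/-- **The elliptic value: `Φ(⟦γ⟧, ν(K)⁻¹𝟙_K + ν(K′)⁻¹𝟙_{K′} − ν(I)⁻¹𝟙_I) = #Fix_γ(G⧸K) + #Fix_γ(G⧸K′) − #Fix_γ(G⧸I)`** at a regular `γ ∈ U(H)(L⁺_v)` with COMPACT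
centraliser, `m` canonical for the regular classes (★ p842426 `classOrbitalIntegral_indicator_complex_local_eq_natCard_fixedBy_mul` for `C = K, K′, I`; `ν(C) ∈ (0, ∞)`).
[cite: Kottwitz1988, §2 Theorem 2] [cite: Laumon1995, Lemma (5.3.2) p. 136] [cite: Rogawski1990, §4.9 p. 54] -/
theorem classOrbitalIntegral_epCombination_eq_of_compactSpace (hH : (H.map (cmConjRingHom L))ᵀ = H) (hdet : H.det ≠ 0)
    {m : OrbitalMeasureFamily ((UnitaryGroup.cmDatum L N H).Local v)}
    (hm : m.IsCanonical (fun γ' => IsRegularElt (γ'.val : GL (Fin N) (UnitaryGroup.LocalRing L v))) ν)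
    (K K' I : Subgroup ((UnitaryGroup.cmDatum L N H).Local v))
    (hKo : IsOpen (K : Set ((UnitaryGroup.cmDatum L N H).Local v))) (hKc : IsCompact (K : Set ((UnitaryGroup.cmDatum L N H).Local v)))
    (hK'o : IsOpen (K' : Set ((UnitaryGroup.cmDatum L N H).Local v))) (hK'c : IsCompact (K' : Set ((UnitaryGroup.cmDatum L N H).Local v)))
    (hIo : IsOpen (I : Set ((UnitaryGroup.cmDatum L N H).Local v))) (hIc : IsCompact (I : Set ((UnitaryGroup.cmDatum L N H).Local v)))
    (γ : (UnitaryGroup.cmDatum L N H).Local v) (hreg : IsRegularElt (γ.val : GL (Fin N) (UnitaryGroup.LocalRing L v)))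
    [CompactSpace (Subgroup.centralizer ({γ} : Set ((UnitaryGroup.cmDatum L N H).Local v)))] :
    classOrbitalIntegral m (fun g => (((ν K).toReal : ℂ))⁻¹ * (K : Set ((UnitaryGroup.cmDatum L N H).Local v)).indicator (fun _ => (1 : ℂ)) g +
        (((ν K').toReal : ℂ))⁻¹ * (K' : Set ((UnitaryGroup.cmDatum L N H).Local v)).indicator (fun _ => (1 : ℂ)) g -
        (((ν I).toReal : ℂ))⁻¹ * (I : Set ((UnitaryGroup.cmDatum L N H).Local v)).indicator (fun _ => (1 : ℂ)) g) (ConjClasses.mk γ) =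
      (Nat.card (MulAction.fixedBy ((UnitaryGroup.cmDatum L N H).Local v ⧸ K) γ) : ℂ) +
        (Nat.card (MulAction.fixedBy ((UnitaryGroup.cmDatum L N H).Local v ⧸ K') γ) : ℂ) -
        (Nat.card (MulAction.fixedBy ((UnitaryGroup.cmDatum L N H).Local v ⧸ I) γ) : ℂ) := by
  have hval : ∀ (C : Subgroup ((UnitaryGroup.cmDatum L N H).Local v)), IsOpen (C : Set ((UnitaryGroup.cmDatum L N H).Local v)) →
      IsCompact (C : Set ((UnitaryGroup.cmDatum L N H).Local v)) →
      (((ν C).toReal : ℂ))⁻¹ * classOrbitalIntegral m ((C : Set ((UnitaryGroup.cmDatum L N H).Local v)).indicator fun _ => (1 : ℂ)) (ConjClasses.mk γ) =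
        (Nat.card (MulAction.fixedBy ((UnitaryGroup.cmDatum L N H).Local v ⧸ C) γ) : ℂ) := by
    intro C hC hCc
    have hpos : 0 < (ν C).toReal := ENNReal.toReal_pos (hC.measure_pos ν ⟨1, C.one_mem⟩).ne' hCc.measure_lt_top.ne
    have hne : ((ν C).toReal : ℂ) ≠ 0 := Complex.ofReal_ne_zero.2 hpos.ne'
    rw [UnitaryGroup.classOrbitalIntegral_indicator_complex_local_eq_natCard_fixedBy_mul L N H v ν hH hdet hm C hC hCc γ hreg, mul_comm,
      mul_assoc, mul_inv_cancel₀ hne, mul_one]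
  rw [classOrbitalIntegral_epCombination_eq L N H v hH hdet hm.isAdmissibleOn K K' I hKo hKc hK'o hK'c hIo hIc _ _ _ γ hreg, hval K hKo hKc,
    hval K' hK'o hK'c, hval I hIo hIc]

/-- **(R2-g) THE GLUE.**  On `U(H)(L⁺_v)` (`H` hermitian, `det H ≠ 0`) with Haar measure `ν` and `m` CANONICAL for the regular classes, let `K, K′, I` be compact open
subgroups such that
(E) at every regular `γ` with COMPACT centraliser `#Fix_γ(G⧸K) + #Fix_γ(G⧸K′) = #Fix_γ(G⧸I) + 1` (Kottwitz: the `γ`-fixed subtree has Euler characteristic `1`), and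
(N) at every regular `γ` with NON-COMPACT centraliser `ν(K)⁻¹Φ(⟦γ⟧,𝟙_K) + ν(K′)⁻¹Φ(⟦γ⟧,𝟙_{K′}) − ν(I)⁻¹Φ(⟦γ⟧,𝟙_I) = 0` (vertices − edges `= 0` per period of the split
torus on its fixed apartment tube).  THEN `f_EP := ν(K)⁻¹𝟙_K + ν(K′)⁻¹𝟙_{K′} − ν(I)⁻¹𝟙_I ∈ C_c^∞` has `Φ(⟦γ⟧, f_EP) = 1` at every elliptic regular `γ` and `= 0` at every
non-elliptic regular `γ` — the body of ★ `RankOneEulerPoincareNonsplit` at `(L, v, ν, m)`, for any rank.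
[cite: Kottwitz1988, §2 Theorem 2] [cite: Rogawski1990, §12.6 p. 174; §4.9 p. 54] [cite: Laumon1995, Thm. (5.1.3)] -/
theorem exists_isLocSmooth_classOrbitalIntegral_eq_one_zero_of_relations (hH : (H.map (cmConjRingHom L))ᵀ = H) (hdet : H.det ≠ 0)
    {m : OrbitalMeasureFamily ((UnitaryGroup.cmDatum L N H).Local v)}
    (hm : m.IsCanonical (fun γ' => IsRegularElt (γ'.val : GL (Fin N) (UnitaryGroup.LocalRing L v))) ν)
    (K K' I : Subgroup ((UnitaryGroup.cmDatum L N H).Local v))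
    (hKo : IsOpen (K : Set ((UnitaryGroup.cmDatum L N H).Local v))) (hKc : IsCompact (K : Set ((UnitaryGroup.cmDatum L N H).Local v)))
    (hK'o : IsOpen (K' : Set ((UnitaryGroup.cmDatum L N H).Local v))) (hK'c : IsCompact (K' : Set ((UnitaryGroup.cmDatum L N H).Local v)))
    (hIo : IsOpen (I : Set ((UnitaryGroup.cmDatum L N H).Local v))) (hIc : IsCompact (I : Set ((UnitaryGroup.cmDatum L N H).Local v)))
    (hE : ∀ γ : (UnitaryGroup.cmDatum L N H).Local v, IsRegularElt (γ.val : GL (Fin N) (UnitaryGroup.LocalRing L v)) →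
      CompactSpace (Subgroup.centralizer ({γ} : Set ((UnitaryGroup.cmDatum L N H).Local v))) →
      Nat.card (MulAction.fixedBy ((UnitaryGroup.cmDatum L N H).Local v ⧸ K) γ) + Nat.card (MulAction.fixedBy ((UnitaryGroup.cmDatum L N H).Local v ⧸ K') γ) =
        Nat.card (MulAction.fixedBy ((UnitaryGroup.cmDatum L N H).Local v ⧸ I) γ) + 1)
    (hN : ∀ γ : (UnitaryGroup.cmDatum L N H).Local v, IsRegularElt (γ.val : GL (Fin N) (UnitaryGroup.LocalRing L v)) →
      ¬ CompactSpace (Subgroup.centralizer ({γ} : Set ((UnitaryGroup.cmDatum L N H).Local v))) →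
      (((ν K).toReal : ℂ))⁻¹ * classOrbitalIntegral m ((K : Set ((UnitaryGroup.cmDatum L N H).Local v)).indicator fun _ => (1 : ℂ)) (ConjClasses.mk γ) +
        (((ν K').toReal : ℂ))⁻¹ * classOrbitalIntegral m ((K' : Set ((UnitaryGroup.cmDatum L N H).Local v)).indicator fun _ => (1 : ℂ)) (ConjClasses.mk γ) -
        (((ν I).toReal : ℂ))⁻¹ * classOrbitalIntegral m ((I : Set ((UnitaryGroup.cmDatum L N H).Local v)).indicator fun _ => (1 : ℂ)) (ConjClasses.mk γ) = 0) :
    ∃ f : (UnitaryGroup.cmDatum L N H).Local v → ℂ, IsLocSmooth f ∧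
      (∀ γ : (UnitaryGroup.cmDatum L N H).Local v, IsRegularElt (γ.val : GL (Fin N) (UnitaryGroup.LocalRing L v)) →
        CompactSpace (Subgroup.centralizer ({γ} : Set ((UnitaryGroup.cmDatum L N H).Local v))) → classOrbitalIntegral m f (ConjClasses.mk γ) = 1) ∧
      (∀ γ : (UnitaryGroup.cmDatum L N H).Local v, IsRegularElt (γ.val : GL (Fin N) (UnitaryGroup.LocalRing L v)) →
        ¬ CompactSpace (Subgroup.centralizer ({γ} : Set ((UnitaryGroup.cmDatum L N H).Local v))) → classOrbitalIntegral m f (ConjClasses.mk γ) = 0) := by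
  refine ⟨fun g => (((ν K).toReal : ℂ))⁻¹ * (K : Set ((UnitaryGroup.cmDatum L N H).Local v)).indicator (fun _ => (1 : ℂ)) g +
      (((ν K').toReal : ℂ))⁻¹ * (K' : Set ((UnitaryGroup.cmDatum L N H).Local v)).indicator (fun _ => (1 : ℂ)) g -
      (((ν I).toReal : ℂ))⁻¹ * (I : Set ((UnitaryGroup.cmDatum L N H).Local v)).indicator (fun _ => (1 : ℂ)) g,
    isLocSmooth_epCombination K K' I hKo hKc hK'o hK'c hIo hIc _ _ _, fun γ hreg hc => ?_, fun γ hreg hnc => ?_⟩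
  · rw [classOrbitalIntegral_epCombination_eq_of_compactSpace L N H v ν hH hdet hm K K' I hKo hKc hK'o hK'c hIo hIc γ hreg]
    have h := hE γ hreg hc
    have h' : (Nat.card (MulAction.fixedBy ((UnitaryGroup.cmDatum L N H).Local v ⧸ K) γ) : ℂ) +
        (Nat.card (MulAction.fixedBy ((UnitaryGroup.cmDatum L N H).Local v ⧸ K') γ) : ℂ) =
        (Nat.card (MulAction.fixedBy ((UnitaryGroup.cmDatum L N H).Local v ⧸ I) γ) : ℂ) + 1 := by exact_mod_cast h
    rw [h', add_sub_cancel_left]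
  · rw [classOrbitalIntegral_epCombination_eq L N H v hH hdet hm.isAdmissibleOn K K' I hKo hKc hK'o hK'c hIo hIc _ _ _ γ hreg]
    exact hN γ hreg hnc

/-- **The glue with (E) read on a ONE-PLACE MODEL.**  For a group isomorphism `e : U(H)(L⁺_v) ≃* U_w` and subgroups `K_w, K′_w, I_w ≤ U_w` whose pull-backs
`C := C_w.comap e` are compact open, the elliptic relation may be checked as `#Fix_{eγ}(U_w⧸K_w) + #Fix_{eγ}(U_w⧸K′_w) = #Fix_{eγ}(U_w⧸I_w) + 1` (★
`natCard_fixedBy_quotient_congr`) — the currency in which the road's lattice counts are stated (`e = localNonsplitEquiv …`, `K_w = unitaryInt σ_w Φ_w`, `K′_w` the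
`ϖ`-modular vertex stabiliser, `I_w = K_w ⊓ K′_w`). [cite: Kottwitz1988, §2 Theorem 2] [cite: Rogawski1990, §12.6 p. 174] -/
theorem exists_isLocSmooth_classOrbitalIntegral_eq_one_zero_of_relations_congr (hH : (H.map (cmConjRingHom L))ᵀ = H) (hdet : H.det ≠ 0)
    {m : OrbitalMeasureFamily ((UnitaryGroup.cmDatum L N H).Local v)}
    (hm : m.IsCanonical (fun γ' => IsRegularElt (γ'.val : GL (Fin N) (UnitaryGroup.LocalRing L v))) ν)
    {U : Type*} [Group U] (e : (UnitaryGroup.cmDatum L N H).Local v ≃* U) (Kw K'w Iw : Subgroup U)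
    (hKo : IsOpen (Kw.comap e.toMonoidHom : Set ((UnitaryGroup.cmDatum L N H).Local v)))
    (hKc : IsCompact (Kw.comap e.toMonoidHom : Set ((UnitaryGroup.cmDatum L N H).Local v)))
    (hK'o : IsOpen (K'w.comap e.toMonoidHom : Set ((UnitaryGroup.cmDatum L N H).Local v)))
    (hK'c : IsCompact (K'w.comap e.toMonoidHom : Set ((UnitaryGroup.cmDatum L N H).Local v)))
    (hIo : IsOpen (Iw.comap e.toMonoidHom : Set ((UnitaryGroup.cmDatum L N H).Local v)))
    (hIc : IsCompact (Iw.comap e.toMonoidHom : Set ((UnitaryGroup.cmDatum L N H).Local v)))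
    (hE : ∀ γ : (UnitaryGroup.cmDatum L N H).Local v, IsRegularElt (γ.val : GL (Fin N) (UnitaryGroup.LocalRing L v)) →
      CompactSpace (Subgroup.centralizer ({γ} : Set ((UnitaryGroup.cmDatum L N H).Local v))) →
      Nat.card (MulAction.fixedBy (U ⧸ Kw) (e γ)) + Nat.card (MulAction.fixedBy (U ⧸ K'w) (e γ)) = Nat.card (MulAction.fixedBy (U ⧸ Iw) (e γ)) + 1)
    (hN : ∀ γ : (UnitaryGroup.cmDatum L N H).Local v, IsRegularElt (γ.val : GL (Fin N) (UnitaryGroup.LocalRing L v)) →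
      ¬ CompactSpace (Subgroup.centralizer ({γ} : Set ((UnitaryGroup.cmDatum L N H).Local v))) →
      (((ν (Kw.comap e.toMonoidHom : Set ((UnitaryGroup.cmDatum L N H).Local v))).toReal : ℂ))⁻¹ *
          classOrbitalIntegral m ((Kw.comap e.toMonoidHom : Set ((UnitaryGroup.cmDatum L N H).Local v)).indicator fun _ => (1 : ℂ)) (ConjClasses.mk γ) +
        (((ν (K'w.comap e.toMonoidHom : Set ((UnitaryGroup.cmDatum L N H).Local v))).toReal : ℂ))⁻¹ *
          classOrbitalIntegral m ((K'w.comap e.toMonoidHom : Set ((UnitaryGroup.cmDatum L N H).Local v)).indicator fun _ => (1 : ℂ)) (ConjClasses.mk γ) -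
        (((ν (Iw.comap e.toMonoidHom : Set ((UnitaryGroup.cmDatum L N H).Local v))).toReal : ℂ))⁻¹ *
          classOrbitalIntegral m ((Iw.comap e.toMonoidHom : Set ((UnitaryGroup.cmDatum L N H).Local v)).indicator fun _ => (1 : ℂ)) (ConjClasses.mk γ) = 0) :
    ∃ f : (UnitaryGroup.cmDatum L N H).Local v → ℂ, IsLocSmooth f ∧
      (∀ γ : (UnitaryGroup.cmDatum L N H).Local v, IsRegularElt (γ.val : GL (Fin N) (UnitaryGroup.LocalRing L v)) →
        CompactSpace (Subgroup.centralizer ({γ} : Set ((UnitaryGroup.cmDatum L N H).Local v))) → classOrbitalIntegral m f (ConjClasses.mk γ) = 1) ∧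
      (∀ γ : (UnitaryGroup.cmDatum L N H).Local v, IsRegularElt (γ.val : GL (Fin N) (UnitaryGroup.LocalRing L v)) →
        ¬ CompactSpace (Subgroup.centralizer ({γ} : Set ((UnitaryGroup.cmDatum L N H).Local v))) → classOrbitalIntegral m f (ConjClasses.mk γ) = 0) := by
  refine exists_isLocSmooth_classOrbitalIntegral_eq_one_zero_of_relations L N H v ν hH hdet hm (Kw.comap e.toMonoidHom) (K'w.comap e.toMonoidHom)
    (Iw.comap e.toMonoidHom) hKo hKc hK'o hK'c hIo hIc (fun γ hreg hc => ?_) hN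
  rw [natCard_fixedBy_quotient_congr (Kw.comap e.toMonoidHom) Kw e (fun g => Iff.rfl) γ,
    natCard_fixedBy_quotient_congr (K'w.comap e.toMonoidHom) K'w e (fun g => Iff.rfl) γ,
    natCard_fixedBy_quotient_congr (Iw.comap e.toMonoidHom) Iw e (fun g => Iff.rfl) γ]
  exact hE γ hreg hc

/-- **The glue along a TOPOLOGICAL one-place model `e : U(H)(L⁺_v) ≃ₜ* U_w`** (e.g. ★ `localNonsplitEquiv`): openness and compactness are then checked on `K_w, K′_w, I_w ≤ U_w`
themselves (pulled back along the homeomorphism `e`), (E) on `U_w`, (N) on the pull-backs `C_w.comap e`. [cite: Kottwitz1988, §2 Theorem 2] [cite: Rogawski1990, §12.6 p. 174] -/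
theorem exists_isLocSmooth_classOrbitalIntegral_eq_one_zero_of_relations_congr' (hH : (H.map (cmConjRingHom L))ᵀ = H) (hdet : H.det ≠ 0)
    {m : OrbitalMeasureFamily ((UnitaryGroup.cmDatum L N H).Local v)}
    (hm : m.IsCanonical (fun γ' => IsRegularElt (γ'.val : GL (Fin N) (UnitaryGroup.LocalRing L v))) ν)
    {U : Type*} [Group U] [TopologicalSpace U] (e : (UnitaryGroup.cmDatum L N H).Local v ≃ₜ* U) (Kw K'w Iw : Subgroup U)
    (hKo : IsOpen (Kw : Set U)) (hKc : IsCompact (Kw : Set U)) (hK'o : IsOpen (K'w : Set U)) (hK'c : IsCompact (K'w : Set U))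
    (hIo : IsOpen (Iw : Set U)) (hIc : IsCompact (Iw : Set U))
    (hE : ∀ γ : (UnitaryGroup.cmDatum L N H).Local v, IsRegularElt (γ.val : GL (Fin N) (UnitaryGroup.LocalRing L v)) →
      CompactSpace (Subgroup.centralizer ({γ} : Set ((UnitaryGroup.cmDatum L N H).Local v))) →
      Nat.card (MulAction.fixedBy (U ⧸ Kw) (e γ)) + Nat.card (MulAction.fixedBy (U ⧸ K'w) (e γ)) = Nat.card (MulAction.fixedBy (U ⧸ Iw) (e γ)) + 1)
    (hN : ∀ γ : (UnitaryGroup.cmDatum L N H).Local v, IsRegularElt (γ.val : GL (Fin N) (UnitaryGroup.LocalRing L v)) →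
      ¬ CompactSpace (Subgroup.centralizer ({γ} : Set ((UnitaryGroup.cmDatum L N H).Local v))) →
      (((ν (Kw.comap e.toMulEquiv.toMonoidHom : Set ((UnitaryGroup.cmDatum L N H).Local v))).toReal : ℂ))⁻¹ *
          classOrbitalIntegral m ((Kw.comap e.toMulEquiv.toMonoidHom : Set ((UnitaryGroup.cmDatum L N H).Local v)).indicator fun _ => (1 : ℂ))
            (ConjClasses.mk γ) +
        (((ν (K'w.comap e.toMulEquiv.toMonoidHom : Set ((UnitaryGroup.cmDatum L N H).Local v))).toReal : ℂ))⁻¹ *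
          classOrbitalIntegral m ((K'w.comap e.toMulEquiv.toMonoidHom : Set ((UnitaryGroup.cmDatum L N H).Local v)).indicator fun _ => (1 : ℂ))
            (ConjClasses.mk γ) -
        (((ν (Iw.comap e.toMulEquiv.toMonoidHom : Set ((UnitaryGroup.cmDatum L N H).Local v))).toReal : ℂ))⁻¹ *
          classOrbitalIntegral m ((Iw.comap e.toMulEquiv.toMonoidHom : Set ((UnitaryGroup.cmDatum L N H).Local v)).indicator fun _ => (1 : ℂ))
            (ConjClasses.mk γ) = 0) :
    ∃ f : (UnitaryGroup.cmDatum L N H).Local v → ℂ, IsLocSmooth f ∧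
      (∀ γ : (UnitaryGroup.cmDatum L N H).Local v, IsRegularElt (γ.val : GL (Fin N) (UnitaryGroup.LocalRing L v)) →
        CompactSpace (Subgroup.centralizer ({γ} : Set ((UnitaryGroup.cmDatum L N H).Local v))) → classOrbitalIntegral m f (ConjClasses.mk γ) = 1) ∧
      (∀ γ : (UnitaryGroup.cmDatum L N H).Local v, IsRegularElt (γ.val : GL (Fin N) (UnitaryGroup.LocalRing L v)) →
        ¬ CompactSpace (Subgroup.centralizer ({γ} : Set ((UnitaryGroup.cmDatum L N H).Local v))) → classOrbitalIntegral m f (ConjClasses.mk γ) = 0) :=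
  have hpre : ∀ C : Subgroup U, (C.comap e.toMulEquiv.toMonoidHom : Set ((UnitaryGroup.cmDatum L N H).Local v)) = e ⁻¹' (C : Set U) := fun _ => rfl
  exists_isLocSmooth_classOrbitalIntegral_eq_one_zero_of_relations_congr L N H v ν hH hdet hm e.toMulEquiv Kw K'w Iw
    (by rw [hpre]; exact hKo.preimage e.continuous) (by rw [hpre]; exact e.toHomeomorph.isCompact_preimage.2 hKc)
    (by rw [hpre]; exact hK'o.preimage e.continuous) (by rw [hpre]; exact e.toHomeomorph.isCompact_preimage.2 hK'c)
    (by rw [hpre]; exact hIo.preimage e.continuous) (by rw [hpre]; exact e.toHomeomorph.isCompact_preimage.2 hIc) hE hN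

end CM


end Literature.NumberTheory.Rogawski1990

end
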